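import Mathlib
import Summits.ResolutionOfSingularities.ResolutionOfSingularities.Theses.HomologicalConductor
import Summits.ResolutionOfSingularities.ResolutionOfSingularities.Theorems.HomologicalConductorPersistenceLevel
import HarnessLib

/-!
# Rung S-2 `PersistenceSurface` (stmt-ResolutionOfSingularities-19970) — the LEVEL-FOUR SPLIT (w44b CRUX-PLAN v7 §2)

[OURS · L1 w44b · planner res-L1-w44b-plan-1 gen 8; typed targets, AI-written, weaker than expert review;
NOT a statement of the manuscript under study.]  SKETCH for ORDER w44b-o3 (a free reserve files it as
`Theorems/HomologicalConductorPersistenceSurfaceLevelFour.lean`, kind definition, `--supports stmt-…-19970 --as helper`).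

Both referees of programme M-rat (tri-1 REFEREE-Mrat-v2 57bb5c5df1682111 §0(a)(ii), tri-2 MRAT-REFEREE 5d6fbe2ad55b1f4b §1 R4-(c))
place its output at Ext-LEVEL FOUR with exponent ONE: at a rational stage, `ca⁴(T̂)·T̂′ ⊆ ca⁴(T̂′)` given (E-sur) + (IW-p)
(no recurrence hypothesis), while `ca(T̂) = ca⁴(T̂)` at the SOURCE stage is the separate residual (⟸ (Rec) = (P-rec)).
This module types that split over the rung's own binders (verbatim those of `Theses.HomologicalConductor.PersistenceSurface`,
with the levelled annihilator `caAt` of `Theorems.HomologicalConductor.PersistenceLevel.LevelPersistence`):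

* `SaturationFourSurface` — at every stage `T_m` of a tower of dimension ≤ 2, `ca(T_m) ⊆ ca⁴(T_m)` (noetherian stabilisation gives
  `ca = ca^{n₀}` for SOME `n₀` for free; the content is `n₀ ≤ 4`);
* `LevelFourPersistenceSurface` — `ca⁴(T_m) ⊆ ca⁴(T_(m+1))` for every `m` (= `LevelPersistence 4` under `ringKrullDim ↥A ≤ 2`);
* `LevelFourShiftPersistenceSurface s` — the hedged form `ca⁴(T_m) ⊆ ca^(4+s)(T_(m+1))`;
* glue: `SaturationFourSurface → LevelFourShiftPersistenceSurface s → PersistenceSurface` (any `s`), and the `s = 0` form.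

WARNING (planner): a failure of `SaturationFourSurface` or of `LevelFourPersistenceSurface` at a non-rational normal stage (Σ6) or at a
non-normal stage 0 (Σ8) would NOT refute `PersistenceSurface`; the split is the shape of the rational-stage argument, filed as vocabulary.
-/

set_option linter.dupNamespace false

namespace Summit.ResolutionOfSingularities.ResolutionOfSingularities.Theorems.HomologicalConductor.PersistenceSurfaceLevelFour

/-- [OURS · w44b v7] SATURATION AT LEVEL FOUR along a surface tower: `ca(T_m) ⊆ ca⁴(T_m)` for every stage (binders verbatim
those of `Theses.HomologicalConductor.PersistenceSurface`). At a complete rational stage this is implied by (Rec) «every indecomposable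
dual special is a direct summand of some `Ω(M_j*)`» (KERNEL-L0 §11.1 + Iyama–Wemyss arXiv:0905.3940 Thm 2.4); automatic at regular and
Gorenstein stages; OPEN in general. NOT a statement of the manuscript. -/
@[conjecture]
def SaturationFourSurface : Prop :=
  ∀ p : ℕ, p.Prime → ∀ (k K : Type) [Field k] [CharP k p] [Field K] [Algebra k K] (O : ValuationSubring K) (A : Subalgebra k K), (∀ c : k, algebraMap k K c ∈ O) → A.FG → IsFractionRing ↥A K → A.toSubring ≤ O.toSubring → ringKrullDim ↥A ≤ 2 → let caAt : ℕ → Subalgebra k K → Set K := fun n A => {x : K | ∃ hx : x ∈ A, ∀ i : ℕ, n ≤ i → ∀ (M N : ModuleCat.{0} ↥A), Module.Finite ↥A M → Module.Finite ↥A N → ∀ e : CategoryTheory.Abelian.Ext.{0} M N i, (⟨x, hx⟩ : ↥A) • e = 0}; let ca : Subalgebra k K → Set K := fun A => {x : K | ∃ hx : x ∈ A, ∃ n : ℕ, ∀ i : ℕ, n ≤ i → ∀ (M N : ModuleCat.{0} ↥A), Module.Finite ↥A M → Module.Finite ↥A N → ∀ e : CategoryTheory.Abelian.Ext.{0} M N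 i, (⟨x, hx⟩ : ↥A) • e = 0}; let loc : Subalgebra k K → Subalgebra k K := fun A => Algebra.adjoin k {y : K | ∃ a ∈ A, ∃ s ∈ A, s⁻¹ ∈ O ∧ y = a * s⁻¹}; let chart : Subalgebra k K → Subalgebra k K := fun A => Algebra.adjoin k ((A : Set K) ∪ {y : K | ∃ c ∈ ca A, ∃ x ∈ ca A, x ≠ 0 ∧ (∀ c' ∈ ca A, c' * x⁻¹ ∈ O) ∧ y = c * x⁻¹}); let nrm : Subalgebra k K → Subalgebra k K := fun B => Algebra.adjoin k {y : K | IsIntegral ↥B y}; let tower : Subalgebra k K → ℕ → Subalgebra k K := fun A m => @Nat.rec (fun _ => Subalgebra k K) (loc A) (fun _ B => loc (nrm (chart B))) m; ∀ m : ℕ, ca (tower A m) ⊆ caAt 4 (tower A m)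

/-- [OURS · w44b v7] LEVEL-FOUR PERSISTENCE along a surface tower: `ca⁴(T_m) ⊆ ca⁴(T_(m+1))` for every `m` — the typed output of
programme M-rat at rational stages (exponent one, no recurrence hypothesis; tri-1 REFEREE-Mrat-v2 §0(a)(ii), tri-2 MRAT-REFEREE §1 R4-(c)),
modulo (E-sur), (IW-p), residue field / completion transport. NOT a statement of the manuscript. -/
@[conjecture]
def LevelFourPersistenceSurface : Prop :=
  ∀ p : ℕ, p.Prime → ∀ (k K : Type) [Field k] [CharP k p] [Field K] [Algebra k K] (O : ValuationSubring K) (A : Subalgebra k K), (∀ c : k, algebraMap k K c ∈ O) → A.FG → IsFractionRing ↥A K → A.toSubring ≤ O.toSubring → ringKrullDim ↥A ≤ 2 → let caAt : ℕ → Subalgebra k K → Set K := fun n A => {x : K | ∃ hx : x ∈ A, ∀ i : ℕ, n ≤ i → ∀ (M N : ModuleCat.{0} ↥A), Module.Finite ↥A M → Module.Finite ↥A N → ∀ e : CategoryTheory.Abelian.Ext.{0} M N i, (⟨x, hx⟩ : ↥A) • e = 0}; let ca : Subalgebra k K → Set K := fun A => {x : K | ∃ hx : x ∈ A, ∃ n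 : ℕ, ∀ i : ℕ, n ≤ i → ∀ (M N : ModuleCat.{0} ↥A), Module.Finite ↥A M → Module.Finite ↥A N → ∀ e : CategoryTheory.Abelian.Ext.{0} M N i, (⟨x, hx⟩ : ↥A) • e = 0}; let loc : Subalgebra k K → Subalgebra k K := fun A => Algebra.adjoin k {y : K | ∃ a ∈ A, ∃ s ∈ A, s⁻¹ ∈ O ∧ y = a * s⁻¹}; let chart : Subalgebra k K → Subalgebra k K := fun A => Algebra.adjoin k ((A : Set K) ∪ {y : K | ∃ c ∈ ca A, ∃ x ∈ ca A, x ≠ 0 ∧ (∀ c' ∈ ca A, c' * x⁻¹ ∈ O) ∧ y = c * x⁻¹}); let nrm : Subalgebra k K → Subalgebra k K := fun B => Algebra.adjoin k {y : K | IsIntegral ↥B y}; let tower : Subalgebra k K → ℕ → Subalgebra k K := fun A m => @Nat.rec (fun _ => Subalgebra k K) (loc A) (fun _ B => loc (nrm (chart B))) m; ∀ m : ℕ, caAt 4 (tower A m) ⊆ caAt 4 (tower A (m + 1))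

/-- [OURS · w44b v7] hedged form: `ca⁴(T_m) ⊆ ca^(4+s)(T_(m+1))` for every `m` (`s = 0` is `LevelFourPersistenceSurface`). -/
@[conjecture]
def LevelFourShiftPersistenceSurface (s : ℕ) : Prop :=
  ∀ p : ℕ, p.Prime → ∀ (k K : Type) [Field k] [CharP k p] [Field K] [Algebra k K] (O : ValuationSubring K) (A : Subalgebra k K), (∀ c : k, algebraMap k K c ∈ O) → A.FG → IsFractionRing ↥A K → A.toSubring ≤ O.toSubring → ringKrullDim ↥A ≤ 2 → let caAt : ℕ → Subalgebra k K → Set K := fun n A => {x : K | ∃ hx : x ∈ A, ∀ i : ℕ, n ≤ i → ∀ (M N : ModuleCat.{0} ↥A), Module.Finite ↥A M → Module.Finite ↥A N → ∀ e : CategoryTheory.Abelian.Ext.{0} M N i, (⟨x, hx⟩ : ↥A) • e = 0}; let ca : Subalgebra k K → Set K := fun A => {x : K | ∃ hx : x ∈ A, ∃ n : ℕ, ∀ i : ℕ, n ≤ i → ∀ (M N : ModuleCat.{0} ↥A), Module.Finite ↥A M → Module.Finite ↥A N → ∀ e : CategoryTheory.Abelian.Ext.{0} M N i, (⟨x, hx⟩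 : ↥A) • e = 0}; let loc : Subalgebra k K → Subalgebra k K := fun A => Algebra.adjoin k {y : K | ∃ a ∈ A, ∃ s ∈ A, s⁻¹ ∈ O ∧ y = a * s⁻¹}; let chart : Subalgebra k K → Subalgebra k K := fun A => Algebra.adjoin k ((A : Set K) ∪ {y : K | ∃ c ∈ ca A, ∃ x ∈ ca A, x ≠ 0 ∧ (∀ c' ∈ ca A, c' * x⁻¹ ∈ O) ∧ y = c * x⁻¹}); let nrm : Subalgebra k K → Subalgebra k K := fun B => Algebra.adjoin k {y : K | IsIntegral ↥B y}; let tower : Subalgebra k K → ℕ → Subalgebra k K := fun A m => @Nat.rec (fun _ => Subalgebra k K) (loc A) (fun _ B => loc (nrm (chart B))) m; ∀ m : ℕ, caAt 4 (tower A m) ⊆ caAt (4 + s) (tower A (m + 1))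

/-- Sanity link: the shift-`0` hedged form is `LevelFourPersistenceSurface` (definitionally). -/
theorem levelFourShiftPersistenceSurface_zero_iff :
    LevelFourShiftPersistenceSurface 0 ↔ LevelFourPersistenceSurface := Iff.rfl

/-- `LevelPersistence 4` (all dimensions) gives the surface statement. -/
theorem levelFourPersistenceSurface_of_levelPersistence_four
    (h : Summit.ResolutionOfSingularities.ResolutionOfSingularities.Theorems.HomologicalConductor.PersistenceLevel.LevelPersistence 4) :
    LevelFourPersistenceSurface := by
  intro p hp k K _ _ _ _ O A hk hA hfr hAO _hdim caAt ca loc chart nrm tower m x hx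
  exact h p hp k K O A hk hA hfr hAO m hx

/-- GLUE (any shift): saturation at level four at the source stage + levelled transfer ⇒ the rung `PersistenceSurface`. -/
theorem persistenceSurface_of_saturationFour_of_levelFourShift (s : ℕ)
    (hS : SaturationFourSurface) (hL : LevelFourShiftPersistenceSurface s) :
    Summit.ResolutionOfSingularities.ResolutionOfSingularities.Theses.HomologicalConductor.PersistenceSurface := by
  intro p hp k K _ _ _ _ O A hk hA hfr hAO hdim ca loc chart nrm tower m x hx
  have hx4 := hS p hp k K O A hk hA hfr hAO hdim m hx
  obtain ⟨hx', h'⟩ := hL p hp k K O A hk hA hfr hAO hdim m hx4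
  exact ⟨hx', 4 + s, h'⟩

/-- GLUE (`s = 0`). -/
theorem persistenceSurface_of_saturationFour_of_levelFour
    (hS : SaturationFourSurface) (hL : LevelFourPersistenceSurface) :
    Summit.ResolutionOfSingularities.ResolutionOfSingularities.Theses.HomologicalConductor.PersistenceSurface :=
  persistenceSurface_of_saturationFour_of_levelFourShift 0 hS hL

end Summit.ResolutionOfSingularities.ResolutionOfSingularities.Theorems.HomologicalConductor.PersistenceSurfaceLevelFour
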